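import Summits.NavierStokesRegularity.NavierStokesRegularity.Theses.RecurrentProfiles
import Summits.NavierStokesRegularity.NavierStokesRegularity.Theses.SqueezeCycle
import Summits.NavierStokesRegularity.NavierStokesRegularity.Theses.RellichScar
import Summits.NavierStokesRegularity.NavierStokesRegularity.Theorems.SqueezeCycleRecurrentLiouvilleRellichScarResidue
import Summits.NavierStokesRegularity.NavierStokesRegularity.Theorems.RecurrentProfilesRecurrentReduction
import Summits.NavierStokesRegularity.NavierStokesRegularity.Theorems.RecurrentLiouville.Negative.KillCriterion
import Summits.NavierStokesRegularity.NavierStokesRegularity.Theorems.RecurrentProfilesRecurrentLiouvilleSmErgodicMeasure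
import Summits.NavierStokesRegularity.NavierStokesRegularity.Theorems.RecurrentProfilesRecurrentLiouvilleSmGenericPoints
import Summits.NavierStokesRegularity.NavierStokesRegularity.Theorems.RecurrentProfilesRecurrentLiouvilleSmGenericRecurrentPoint
import Summits.NavierStokesRegularity.NavierStokesRegularity.Theorems.RecurrentProfilesRecurrentLiouvilleSmGenericReduction
import Summits.NavierStokesRegularity.NavierStokesRegularity.Theorems.RecurrentProfilesRecurrentLiouvilleSmCertificate
import Literature.Dynamics.TopologicalDynamics.UniformRecurrence
import Literature.Dynamics.TopologicalDynamics.MinimalOrbitClosure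
import Literature.Dynamics.TopologicalDynamics.KrylovBogolyubov
import Literature.Dynamics.Ergodic.BirkhoffErgodicTheoremProofs
import Literature.Analysis.FluidPDE.ScalingUniformRecurrence
import Mathlib.Dynamics.Ergodic.Extreme
import Mathlib.Analysis.Convex.KreinMilman
import Mathlib.Topology.ContinuousMap.Bounded.Basic
import Mathlib.Topology.Metrizable.Basic
import HarnessLib

/-!
# Crux `RecurrentLiouville` (stmt-NavierStokesRegularity-1589) — line `Sketch`, skeleton v11 (lead c13 = v10 of lead c12, content unchanged):
# the CANONICAL RESIDUE (items 11716 ∧ 11719, by name) + the STATISTICAL (ergodic) harvest of c12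

Lead c13 (2026-08-17T19:30Z): nothing upstream moved (11716, 11719, 1588 open; Disproof gen 2 unchanged); no new
harvest family registered (strategist census §1/§6: every stub over singular class profiles is crux-equivalent by
compactness; presearch fired no reopen trigger).  Registered stubs = R1, R2 only; verdict `blocked-on: stmt-11716`.

The crux (`Theses.RecurrentProfiles.RecurrentLiouville` = `Theses.SqueezeCycle.RecurrentLiouville`,
`Iff.rfl`): a suitable weak solution `(u, p)` of Navier–Stokes (`ν = 1`) on the backward slab
`(-∞,0) × ℝ³` with weak gradient `G`, Albritton–Barker `𝐈 < ⊤`, the rate `‖u‖ ≤ C/√(−t)` and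
UNIFORMLY RECURRENT under the scaling flow `σ ↦ u_{e^σ}` is regular at the origin.

## State of the chain (tree `Cruxes/RecurrentLiouville/{NOTES,PICKED,STRATEGY-CENSUS}.md`)

Both payload lines are certified dead (c6–c11 `Sketch`, a1 `Ideator5Round2Sketch`); the crux ⟺
items 11716 ∧ 11719 (`recurrentLiouville_iff_rellichScar`, p128754), both research-open;
`¬crux ⟺ TypeISingularProfileExists` (p116351).  This skeleton keeps the HONEST registration of
c5/c6/c11 — the two open stubs of the composition are VERBATIM the two open items, BY NAME — and
registers next to it one recurrence-native harvest no earlier seat typed: the docstring's tool (b)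
(Krylov–Bogolyubov measures on the hull) made operational as far as the tree's vocabulary allows
without a phase-space definition item — ERGODIC invariant measures exist (SM1), almost every point
of one is Birkhoff-GENERIC (SM2), every compact invariant set of a pseudo-metrisable flow carries a
generic uniformly recurrent point (SM3), hence the GENERIC RECURRENT REDUCTION (SM4): every Type-I
singularity of the Albritton–Barker class is accompanied by a singular, uniformly recurrent class
member all of whose `L³_loc` statistics along the backward log-scales converge (a Type-I
"stationary statistical solution" in orbit form).

## The composition (residue): crux ⟸ R1 ∧ R2, recurrence-free

* R1 `stub_rsNoApexTypeIProfile` = item stmt-NavierStokesRegularity-11716 `Theses.RellichScar.NoApexTypeIProfile`.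
* R2 `stub_rsApexLocalisation` = item stmt-NavierStokesRegularity-11719 `Theses.RellichScar.ApexLocalisation`.
* `RecurrentLiouville_of` := `recurrentLiouville_of_rellichScar R1 R2` (p128754) — and conversely any
  proof of the crux proves R1 ∧ R2 (`rellichScar_of_recurrentLiouville`), so nothing is hidden.

## The harvest (this seat): SM1–SM4 (none claimed to move the crux; census §1(i))

* SM1 `stub_smErgodicMeasure` (abstract; Einsiedler–Ward 2017 Prop. 8.36 + Thm. 8.80, Brin–Stuck
  2002 Prop. 4.6.2; absent from Mathlib): a continuous self-map of a nonempty compact Hausdorff space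
  with `HasOuterApproxClosed` has an ERGODIC invariant Borel probability measure (tree K–B
  `exists_measurePreserving_of_continuous` + Krein–Milman `IsCompact.extremePoints_nonempty` +
  Mathlib `Ergodic.of_mem_extremePoints`).
* SM2 `stub_smGenericPoints` (abstract; Brin–Stuck 2002 §4.7): for an ergodic invariant probability
  measure of a continuous map of a compact metrisable space, a.e. point is GENERIC — the Birkhoff
  averages of EVERY bounded continuous observable converge to its integral (tree Birkhoff
  `birkhoff_ergodic_theorem_of_ergodic_holds` + separability of `C(X)`).
* SM3 `stub_smGenericRecurrentPoint` (abstract): a compact invariant nonempty set of an `ℝ`-flow by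
  continuous maps on a pseudo-metrisable space contains a UNIFORMLY RECURRENT point along whose
  backward unit steps the Cesàro averages of every bounded continuous observable converge
  (separation quotient, minimal set, SM1 on it, SM2, two-sidedness, lift).
* SM4 `stub_smGenericReduction` (Navier–Stokes): GENERIC RECURRENT REDUCTION in the A–B class.

## References

* M. Einsiedler, T. Ward, *Functional Analysis, Spectral Theory, and Applications*, GTM 276 (2017),
  Prop. 8.36, Thm. 8.80, §8.6.1. [EinsiedlerWard2017]
* M. Brin, G. Stuck, *Introduction to Dynamical Systems*, CUP (2002), Prop. 4.6.2, §4.7.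
* H. Furstenberg, *Recurrence in Ergodic Theory and Combinatorial Number Theory* (1981), Ch. 1 §4,
  Thms 1.15–1.17. [Furstenberg1981]
* D. Albritton, T. Barker, J. Math. Fluid Mech. 21 (2019) no. 43 = arXiv:1811.00502, Lemma 2.2,
  Prop. 2.3. [AlbrittonBarker2019]
-/

noncomputable section

-- the sub-problem namespace repeats the summit name (D-0017 layout `Summit.<S>.<P>.Theorems`)
set_option linter.dupNamespace false

namespace Summit.NavierStokesRegularity.NavierStokesRegularity.Theorems

open MeasureTheory Set Function Filter Topology TopologicalSpace Metric
open Literature.Analysis Literature.Analysis.FluidPDE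
open Literature.Dynamics.TopologicalDynamics
open scoped NNReal ENNReal BoundedContinuousFunction

/-! ## Residue stub R1 — item stmt-NavierStokesRegularity-11716, by name (research-open; NOT claimed) -/

/-- **R1 = item stmt-NavierStokesRegularity-11716** `RellichScar.NoApexTypeIProfile` (apex-class
Type-I Liouville, KNSS 2009 (1.6)).  Research-open; the `sorry` stands for that item and is
discharged by `RellichScar.NoApexTypeIProfile_holds` the day it closes. -/
theorem stub_rsNoApexTypeIProfile : Theses.RellichScar.NoApexTypeIProfile := by
  sorry

/-! ## Residue stub R2 — item stmt-NavierStokesRegularity-11719, by name (research-open; NOT claimed) -/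

/-- **R2 = item stmt-NavierStokesRegularity-11719** `RellichScar.ApexLocalisation`: a rate-class
Type-I singular profile yields an apex-class one.  Research-open; the `sorry` stands for that item
and is discharged by `RellichScar.ApexLocalisation_holds` the day it closes. -/
theorem stub_rsApexLocalisation : Theses.RellichScar.ApexLocalisation := by
  sorry

/-! ## Harvest stub SM1 — ERGODIC Krylov–Bogolyubov — LANDED p172355 (worker W1)
`stub_smErgodicMeasure` : `Theorems/RecurrentProfilesRecurrentLiouvilleSmErgodicMeasure.lean` (imported): a continuous self-map of a
nonempty compact Hausdorff space with `HasOuterApproxClosed` preserves an ERGODIC Borel probability measure (tree K–B p157159 +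
Krein–Milman lemma on the image of the invariant probability measures in `(X →ᵇ ℝ) → ℝ` + `Ergodic.of_mem_extremePoints`;
Einsiedler–Ward 2017 Prop. 8.36 / Thm. 8.80, Brin–Stuck 2002 Prop. 4.6.2; absent from Mathlib). -/

/-- Witness that SM1 is available to the skeleton by name. -/
example := @stub_smErgodicMeasure

/-! ## Harvest stub SM2 — GENERIC POINTS have full measure — LANDED p172509 (worker W2)
`stub_smGenericPoints` : `Theorems/RecurrentProfilesRecurrentLiouvilleSmGenericPoints.lean` (imported): for an ergodic invariant
probability measure of a map of a compact metrisable space, a.e. point is GENERIC — Birkhoff averages of EVERY bounded continuous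
observable converge to its integral simultaneously (tree Birkhoff + separability of `X →ᵇ ℝ`; Brin–Stuck 2002 §4.7; reusable
`smGP_ae_forall_tendsto_birkhoffAverage`, `smGP_separableSpace_boundedContinuousFunction`). -/

/-- Witness that SM2 is available to the skeleton by name. -/
example := @stub_smGenericPoints

/-! ## Harvest stub SM3 — a GENERIC UNIFORMLY RECURRENT point of a compact invariant set — LANDED p172841 (lead)
`stub_smGenericRecurrentPoint` : `Theorems/RecurrentProfilesRecurrentLiouvilleSmGenericRecurrentPoint.lean` (imported): a nonempty
compact invariant set of an `ℝ`-flow by continuous maps (action law, `ϕ 0 = id`) on a pseudo-metrisable space contains a point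
that is UNIFORMLY RECURRENT for the flow and GENERIC along the backward unit steps (Cesàro averages of every bounded continuous
observable converge) — separation quotient, minimal set of `ϕ(−1)`, SM1, SM2, two-sidedness p160858, lift; discrete core
`smGR_exists_generic_recurrent_discrete`. -/

/-- Witness that SM3 is available to the skeleton by name. -/
example := @stub_smGenericRecurrentPoint

/-! ## Harvest stub SM4 — GENERIC RECURRENT REDUCTION in the Albritton–Barker class — LANDED p172940 (lead)
`stub_smGenericReduction` : `Theorems/RecurrentProfilesRecurrentLiouvilleSmGenericReduction.lean` (imported): if a suitable weak
slab solution with weak gradient, `𝐈 < ⊤` and rate `C` is singular at the origin, there is an origin-singular class member `w`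
(same `C`) that is UNIFORMLY RECURRENT under scaling AND GENERIC along the backward log-scales: for every `n` and every bounded
functional `Ψ` of fields continuous for the `L³(Q(0, n+1))`-seminorm, `(1/N) ∑_{k<N} Ψ (w_{e^{-k}})` converges — all `L³_loc`
statistics of the blow-up sequence exist (orbit form of a Type-I stationary statistical solution; strengthens item 1590). -/

/-- Witness that SM4 is available to the skeleton by name. -/
example := stub_smGenericReduction

/-! ## Harvest stub SM5 — the STATISTICAL CERTIFICATE — file `Theorems/RecurrentProfilesRecurrentLiouvilleSmCertificate.lean` (lead)
`stub_smCertificate` (imported): (i) crux ⟺ GENERIC recurrent Liouville (genericity, like recurrence, is a free normalisation, by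
SM4); (ii) `TypeISingularProfileExists` (p116351) ⟺ a generic uniformly recurrent Type-I singularity model exists. -/

/-- Witness that SM5 is available to the skeleton by name. -/
example := stub_smCertificate

/-! ## What the harvest gives the route: SM4 ⇒ item 1590 (the proved reduction), letter for letter -/

/-- The generic reduction SM4 implies the route's reduction `RecurrentReduction` (item 1590, proved
as `recurrentReduction_proof`): forget the statistics. [folklore] -/
theorem recurrentReduction_of_generic : Theses.RecurrentProfiles.RecurrentReduction := by
  intro u p G C hsw hwg hI hdec hsing
  obtain ⟨w, q, H, hsw', hwg', hI', hdec', hsing', hrec', -⟩ :=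
    stub_smGenericReduction u p G C hsw hwg hI hdec hsing
  exact ⟨w, q, H, hsw', hwg', hI', hdec', hsing', hrec'⟩

/-! ## Composition: the crux from R1 and R2 (recurrence-free), and conversely -/

/-- **The crux from the residue stubs** (composition of line `Sketch`, v10 = v9 = v5): apex
localisation (R2) upgrades an origin-singular class profile to an origin-singular apex-class
profile, apex-class Type-I Liouville (R1) excludes it; recurrence is forgotten (Disproof §A3). -/
theorem RecurrentLiouville_of : Theses.RecurrentProfiles.RecurrentLiouville :=
  recurrentLiouville_of_rellichScar stub_rsNoApexTypeIProfile stub_rsApexLocalisation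

/-- **The crux in its SqueezeCycle copy** (the two route copies agree letter for letter, `Iff.rfl`). -/
theorem RecurrentLiouville_proof : Theses.SqueezeCycle.RecurrentLiouville :=
  RecurrentLiouville_of

/-- Honesty certificate of the composition: the two residue stubs are jointly NECESSARY — any proof
of the crux proves both (p128754). -/
example : Theses.SqueezeCycle.RecurrentLiouville ↔
    (Theses.RellichScar.NoApexTypeIProfile ∧ Theses.RellichScar.ApexLocalisation) :=
  recurrentLiouville_iff_rellichScar

end Summit.NavierStokesRegularity.NavierStokesRegularity.Theorems

end
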